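import Literature.Probability.RandomPlanarGeometry.HexSAWPathRigidity
import Summits.CriticalPhenomena.SAWScalingLimit.Theorems.SAWDevelopingMapSourceLoopBoundSourceLaw

/-!
# The winding of a returning loop around the source vertex

Helper file for the crux `NoFoldBound` (stmt-CriticalPhenomena-8296) of the route
`SAWDevelopingMap` (sub-problem `SAWScalingLimit` of `CriticalPhenomena`), line `Ideator3Sketch`,
leaf `stub_loopWinding`.

Setting (Duminil-Copin–Smirnov 2012, §2): a finite vertex set `Λ` of the hexagonal lattice `ℍ`
with connected complement (`hexDomainSimplyConnected`), the source configuration `u ∉ Λ ∋ v`,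
`v ∼ u, w₁, w₂` pairwise distinct, and a *returning loop* `δ`: a self-avoiding walk of `Λ ∖ {v}`
from the mid-edge `{v, w₂}` to the mid-edge `{v, w₁}` (the walks summed in the second port of the
source law `SourceLoopBound.sourcePort`).  We prove

  `W(δ) = -5 · W(mid{u,v} → c(v) → mid{v,w₂})`,

i.e. `W(δ) = ∓5π/3` when the one-step turn `u → v → w₂` is `±π/3` (`stub_loopWinding`).

## Proof

Code everything in the coordinate model `HV` by the chart `Φ` at the dart `v → w₂`
(`HV.exists_chart`, a similarity of the embedded lattices).  The winding of `δ` is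
`(π/3) · pturn` of its code `Φ v, Φ(δ), Φ v` (`HexMidEdgeSAW.winding_eq_pturn_code`), and the
one-step winding is `(π/3) · turn (Φ u) (Φ v) (Φ w₂)` (`HV.turning_emb_pos`, the end half-edges
being collinear with the edges `u v`, `v w₂`).  The closed-up loop `Φ v :: Φ(δ)` is a simple cycle
of `Φ(Λ)`; the outer vertex `u` is joined off `Λ` (connected complement) to a vertex far to the
right of `Φ(Λ)`, so the faces at `Φ u` have winding number `0`
(`HV.wnd_rightFace_eq_zero_of_far`), and the loop lemma `HV.cturn_eq_neg_six_mul_turn` gives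
`cturn = -6 τ`, `τ = turn (Φ u) (Φ v) (Φ w₂)`.  Finally
`cturn = pturn (code) + turn (Φ w₁) (Φ v) (Φ w₂)` and the last turn is `-τ` at the trivalent
vertex `Φ v` (`HV.turn_eq_neg_turn`), whence `pturn (code) = -5 τ`.
-/

noncomputable section

open Literature.Probability.LatticeModels Literature.Probability.RandomPlanarGeometry.SAW

namespace Summit.CriticalPhenomena.SAWScalingLimit.Theorems.SAWDevelopingMapNoFoldBound

open Literature.Probability.RandomPlanarGeometry.SAW.HV
open Summit.CriticalPhenomena.SAWScalingLimit.Theorems.SourceLoopBound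

variable {Λ : Finset HexVertex} {u : HexVertex}

/-- **The outer vertex is outside every cycle of the domain** (coordinate form of "connected
complement"). If `Λ` has a connected complement in `ℍ` and `u ∉ Λ`, then for every chart
`Φ : hexGraph ≃g hvGraph` and every cyclic vertex list `c` of `Φ(Λ)` with adjacent consecutive
vertices, the face to the right of any dart at `Φ u` has winding number `0`: `u` is joined off
`Λ` to a vertex far to the right of `Φ(Λ)`, along which path the winding number is constant and
finally `0` (`HV.wnd_rightFace_eq_zero_of_far`). -/
theorem wnd_rightFace_eq_zero_of_simplyConnected (hΛ : hexDomainSimplyConnected Λ) (hu : u ∉ Λ)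
    (Φ : hexGraph ≃g hvGraph) {c : List HV} (hc : ∀ x ∈ c, ∃ y ∈ Λ, Φ y = x)
    (hcd : ∀ d ∈ cdarts c, hvGraph.Adj d.1 d.2) {t : HV} (ht : hvGraph.Adj (Φ u) t) :
    wnd c (rightFace (Φ u) t) = 0 := by
  classical
  -- a bound on the first coordinates of `Φ(Λ)`
  obtain ⟨N, hN⟩ := Finset.exists_le (Λ.image fun y => (Φ y).1)
  have hN' : ∀ y ∈ Λ, (Φ y).1 ≤ N := fun y hy => hN _ (Finset.mem_image_of_mem _ hy)
  have hcN : ∀ x ∈ c, x.1 ≤ N := fun x hx => by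
    obtain ⟨y, hy, rfl⟩ := hc x hx
    exact hN' y hy
  -- a far vertex off `Λ`
  set y' : HV := (N + 1, 0, false) with hy'
  have hy₀ : Φ.symm y' ∉ Λ := fun h => by
    have := hN' _ h
    rw [RelIso.apply_symm_apply, hy'] at this
    simp at this
  -- a lattice path from `u` to it avoiding `Λ`, mapped by the chart
  obtain ⟨W⟩ := hΛ ⟨u, by simpa using hu⟩ ⟨Φ.symm y', by simpa using hy₀⟩
  set Q : List HV := W.support.map fun z => Φ z.1 with hQ
  have hQne : Q ≠ [] := by simp [hQ]
  have hQc : Q.IsChain hvGraph.Adj := by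
    rw [hQ, List.isChain_map]
    exact List.IsChain.imp (fun p q h => (Φ.map_rel_iff).2 h) W.isChain_adj_support
  have hQav : ∀ z ∈ Q, z ∉ c := by
    intro z hz hzc
    obtain ⟨p, -, rfl⟩ := List.mem_map.1 hz
    obtain ⟨y, hy, hyp⟩ := hc _ hzc
    exact p.2 (Φ.injective hyp ▸ hy)
  have hQhead : Q.head hQne = Φ u := by
    have : Q = Φ u :: (W.support.tail.map fun z => Φ z.1) := by
      rw [hQ, ← W.cons_tail_support]; rfl
    simp only [this, List.head_cons]
  have hQlast : Q.getLast hQne = y' := by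
    have h1 : Q.getLast hQne = Φ (Φ.symm y') := by
      simp [hQ, List.getLast_map, W.getLast_support]
    rw [h1, RelIso.apply_symm_apply]
  have key := wnd_rightFace_eq_zero_of_far hcd hcN Q hQne hQc hQav (by rw [hQlast, hy']; simp)
    (by rw [hQlast, hy']) (t := t) (by rw [hQhead]; exact ht)
  rwa [hQhead] at key

/-- **The turning of a returning loop** (coordinate model). Let `p :: h :: R` be a simple cycle
of `ℍ` with last vertex `g`, and `s` the third neighbour of `p` (besides `h` and `g`), off the
cycle, with the faces at the edge `{p, s}` outside the cycle (winding number `0`). Then the open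
path `p, h, …, g, p` (the cycle traversed once from `p` back to `p`, without the closing turn at
`p`) turns by `-5 · turn s p h`: the loop lemma gives the turning number `-6 · turn s p h`, and the
closing turn `g → p → h` is `-turn s p h` at the trivalent vertex `p`. -/
theorem pturn_loop_eq_neg_five_mul_turn {p h g s : HV} {R : List HV} (hcyc : IsCyc (p :: h :: R))
    (hg : (p :: h :: R).getLast (List.cons_ne_nil _ _) = g) (hs : hvGraph.Adj p s)
    (hh : hvGraph.Adj p h) (hgp : hvGraph.Adj p g) (hsh : s ≠ h) (hhg : h ≠ g) (hsg : s ≠ g)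
    (hsn : s ∉ p :: h :: R) (h0 : wnd (p :: h :: R) (leftFace p s) = 0) :
    pturn (p :: h :: R ++ [p]) = -5 * turn s p h := by
  have hct := cturn_eq_neg_six_mul_turn hcyc (List.cons_ne_nil _ _) hs hsn h0
  have e6 : cturn (p :: h :: R) = pturn (p :: h :: R ++ [p]) + turn g p h := by
    rw [cturn, show (p :: h :: R).take 2 = [p, h] from rfl,
      pturn_concat_turn (p :: h :: R) (List.cons_ne_nil _ _) p h, hg]
  have t1 : turn g p h = -turn s p h := turn_eq_neg_turn hs hh hgp hsh hhg hsg
  simp only [List.head_cons] at hct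
  linarith

/-- **The one-step winding at a vertex is `(π/3)` times the lattice turn**: for neighbours
`u, w` of `v` (`u ≠ w`) and a chart `Φ` acting on the embedded lattice by a similarity, the
winding of the polyline `mid{u,v} → c(v) → mid{v,w}` is `(π/3) · turn (Φ u) (Φ v) (Φ w)` (the
half-edges are collinear with the edges `u v` and `v w`, similarities preserve turning angles,
and lattice turns are `±π/3`). -/
theorem winding_midpoints_eq_turn {v w : HexVertex} {Φ : hexGraph ≃g hvGraph} {α β : ℂ}
    (huv : hexGraph.Adj v u) (hvw : hexGraph.Adj v w) (huw : u ≠ w)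
    (haff : ∀ f, emb (pos (Φ f)) = α * hexCenter f + β) (hα : α ≠ 0) :
    winding [hexMidpoint s(u, v), hexCenter v, hexMidpoint s(v, w)] =
      Real.pi / 3 * turn (Φ u) (Φ v) (Φ w) := by
  have hm₁ : hexMidpoint s(u, v) = hexCenter v + (1 / 2 : ℝ) * (hexCenter u - hexCenter v) := by
    rw [hexMidpoint_mk]; push_cast; ring
  have hm₂ : hexMidpoint s(v, w) = hexCenter v + (1 / 2 : ℝ) * (hexCenter w - hexCenter v) := by
    rw [hexMidpoint_mk]; push_cast; ring
  have avu : hvGraph.Adj (Φ u) (Φ v) := (Φ.map_rel_iff).2 huv.symm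
  have avw : hvGraph.Adj (Φ v) (Φ w) := (Φ.map_rel_iff).2 hvw
  rw [winding_cons_cons_cons, winding_pair, add_zero, hm₁, hm₂, turning_left_ray (by norm_num),
    turning_right_ray (by norm_num), ← turning_emb_pos avu avw (Φ.injective.ne huw), haff, haff,
    haff, turning_affine hα]

/-- **Stub W1 (loop winding).** In a simply connected domain, for the source configuration
`u ∉ Λ ∋ v`, `v ∼ u, w₁, w₂`, every returning loop `δ` of `Λ ∖ {v}` from the mid-edge `{v, w₂}`
to the mid-edge `{v, w₁}` has winding `-5` times the one-step turn `mid{u,v} → c(v) → mid{v,w₂}`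
(i.e. `∓5π/3` when that turn is `±π/3`): the loop closed up through `v` is a simple lattice
polygon with `u` outside (connected complement), so it turns by `∓2π` (loop lemma
`HV.cturn_eq_neg_six_mul_turn`), and removing the two turns at `v` leaves `-5` one-step turns.
(Duminil-Copin–Smirnov 2012, proof of Lemma 1: "we used the fact that `a` is on the boundary and
`Ω` is simply connected".) -/
theorem stub_loopWinding :
    ∀ (Λ : Finset HexVertex), hexDomainSimplyConnected Λ →
      ∀ (u v w₁ w₂ : HexVertex), u ∉ Λ → v ∈ Λ → hexGraph.Adj v u → hexGraph.Adj v w₁ →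
        hexGraph.Adj v w₂ → u ≠ w₁ → u ≠ w₂ → w₁ ≠ w₂ →
        ∀ δ : HexMidEdgeSAW (Λ.erase v) s(v, w₂) s(v, w₁),
          δ.winding = -5 * winding [hexMidpoint s(u, v), hexCenter v, hexMidpoint s(v, w₂)] := by
  intro Λ hΛ u v w₁ w₂ hu hv huv h₁ h₂ hu₁ hu₂ h₁₂ δ
  classical
  -- the chart at the dart `v → w₂`
  obtain ⟨Φ, α, β, hα, hΦv, hΦw₂, haff⟩ := exists_chart h₂
  -- adjacencies and distinctness in the model
  have avu : hvGraph.Adj (Φ v) (Φ u) := (Φ.map_rel_iff).2 huv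
  have avw₁ : hvGraph.Adj (Φ v) (Φ w₁) := (Φ.map_rel_iff).2 h₁
  have avw₂ : hvGraph.Adj (Φ v) (Φ w₂) := (Φ.map_rel_iff).2 h₂
  have nuw₁ : Φ u ≠ Φ w₁ := Φ.injective.ne hu₁
  have nuw₂ : Φ u ≠ Φ w₂ := Φ.injective.ne hu₂
  have nw₁w₂ : Φ w₁ ≠ Φ w₂ := Φ.injective.ne h₁₂
  -- the loop: nonempty, starts at `w₂`, ends at `w₁`, avoids `v` and `u`
  have hne : δ.verts ≠ [] := loop_verts_ne_nil h₁ h₁₂ δ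
  obtain ⟨rest, hrest⟩ := loop_head_eq h₁ h₁₂ δ
  have hvδ : v ∉ δ.verts := fun h => (Finset.mem_erase.1 (δ.subset v h)).1 rfl
  have huδ : u ∉ δ.verts := fun h => hu (Finset.mem_of_mem_erase (δ.subset u h))
  have hlast : δ.verts.getLast hne = w₁ := by
    rcases δ.getLast_eq_or hne with h | h
    · exact absurd h (ne_of_mem_of_not_mem (List.getLast_mem hne) hvδ)
    · exact h
  -- Step 1: the winding of `δ` is `(π/3) · pturn` of its code `Φ v, Φ(δ), Φ v`
  have hW := δ.winding_eq_pturn_code (u := v) (w₁ := w₂) rfl (Finset.notMem_erase v Λ) hΦv hΦw₂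
    h₁ haff hα hne (e := v) (Or.inr ⟨hlast, rfl⟩)
  set R : List HV := rest.map Φ with hR
  have hcode : (v :: δ.verts).map Φ = Φ v :: Φ w₂ :: R := by
    rw [hrest, List.map_cons, List.map_cons]
  have hcode' : δ.verts.map Φ = Φ w₂ :: R := by rw [hrest, List.map_cons]
  rw [hcode', ← hΦv] at hW
  -- Step 2: the closed-up loop `Φ v :: Φ w₂ :: R` is a simple cycle of `Φ(Λ)` ending at `Φ w₁`
  have hmem : ∀ x ∈ Φ v :: Φ w₂ :: R, ∃ y ∈ v :: δ.verts, Φ y = x := fun x hx => by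
    rw [← hcode, List.mem_map] at hx
    exact hx
  have hg : (Φ v :: Φ w₂ :: R).getLast (List.cons_ne_nil _ _) = Φ w₁ := by
    have h1 : ((v :: δ.verts).map Φ).getLast (by simp) = Φ w₁ := by
      rw [List.getLast_map (by simp), List.getLast_cons hne, hlast]
    simpa only [hcode] using h1
  have hRne : R ≠ [] := by
    intro hR0
    simp only [hR0, List.getLast_cons_cons, List.getLast_singleton] at hg
    exact nw₁w₂ hg.symm
  have hcyc : IsCyc (Φ v :: Φ w₂ :: R) := by
    refine ⟨?_, ?_, fun d hd => ?_⟩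
    · have := List.length_pos_of_ne_nil hRne
      simp only [List.length_cons]
      omega
    · rw [← hcode]
      exact (cons_nodup δ).map Φ.injective
    · rw [cdarts_eq (List.cons_ne_nil _ _), List.mem_append, List.mem_singleton] at hd
      rcases hd with hd | rfl
      · have hch : ((v :: δ.verts).map Φ).IsChain hvGraph.Adj := by
          rw [List.isChain_map]
          exact List.IsChain.imp (fun p q h => (Φ.map_rel_iff).2 h) (cons_isChain h₁ h₂ h₁₂ δ)
        rw [hcode] at hch
        exact adj_of_mem_pdarts hch d hd
      · rw [hg, List.head_cons]
        exact avw₁.symm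
  have hsn : Φ u ∉ Φ v :: Φ w₂ :: R := fun h => by
    obtain ⟨y, hy, hyu⟩ := hmem _ h
    have hyu' : y = u := Φ.injective hyu
    subst hyu'
    rcases List.mem_cons.1 hy with h' | h'
    · exact huv.ne (h'.symm)
    · exact huδ h'
  -- Step 3: `u` is outside the cycle (connected complement), so the loop lemma applies
  have h0 : wnd (Φ v :: Φ w₂ :: R) (leftFace (Φ v) (Φ u)) = 0 :=
    wnd_rightFace_eq_zero_of_simplyConnected hΛ hu Φ
      (fun x hx => by
        obtain ⟨y, hy, rfl⟩ := hmem x hx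
        exact ⟨y, cons_subset hv δ y hy, rfl⟩)
      hcyc.2.2 avu.symm
  have key := pturn_loop_eq_neg_five_mul_turn hcyc hg avu avw₂ avw₁ nuw₂ nw₁w₂.symm nuw₁ hsn h0
  -- Step 4: the one-step winding is `(π/3) · turn (Φ u) (Φ v) (Φ w₂)`
  have hτ := winding_midpoints_eq_turn (Φ := Φ) huv h₂ hu₂ haff hα
  simp only [List.cons_append] at hW key
  rw [hW, key, hτ]
  push_cast
  ring

end Summit.CriticalPhenomena.SAWScalingLimit.Theorems.SAWDevelopingMapNoFoldBound
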